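import Summits.QuantumFields.YangMills.Theorems.FluctuationComparisonRegPrIntLS2BetaRowTransportVariance
import HarnessLib

/-!
# CORNER-AVERAGED FLAT-SQUARE STOKES WITH TENT COVERAGE: the `N³` squares of side `N` cornered in one block cost `N⁴ ×` the plaquettes of the `2N × 2N × N` slab, i.e. `E_x dist1 U(∂□_N(x))² ≤ N·Σ_slab`
# (crux `FluctuationComparisonRegPrIntL`, stmt-QuantumFields-20520; registry v11.4 `Cruxes/FluctuationComparisonRegPrIntL/Lines/semiclassical_s2beta.lean` 3732b7df FROZEN, untouched)

Cell `ym3-torus` (YM ladder rung R3 = continuum `SU(2)` Yang–Mills on the three-torus — a RUNG: NOT d = 4, NOT infinite volume, NOT a mass gap, NOT Clay).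
Width seat `ym3-torus-px21` (gen 21); `--kind proof --supports stmt-QuantumFields-20520 --as helper`, count-neutral, DEFINITION-FREE (0 `def`, 0 `instance`,
0 `notation`, 0 `sorry`, default heartbeats).  Pure lattice kinematics for ANY gauge group `G` (`GaugeGroup`) on ANY torus `T^{(j)}` of the tree's `Params`, in the
currency of lit ✓`B10Eq47AxialChi` (`shiftN` ∕ `rect`) and ✓p812130 (7) `…S2BetaRowTransportVariance` (`shiftN_comm` ∕ `shiftN_add` ∕ `dist1_rect_sq_le`).

WHY.  On the linearised `hFlat` road the depth-`j` averaged plaquette loop is, after coupling the member indices, the CORNER-AVERAGE of sharp squares of side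
`N = L^j`: `c_P^{(j)} = E_{x∈B}[∂□_N(x)]` (px8 g21 UV3-NODE §57.8 (A); the tent structure of §57.4 ∕ §58.2), and the KEY LEMMA `‖f^{(j)}‖² ≤ C·N·‖f‖²` is «coverage `1∕N` ×
area `N²`».  This file types the kinematic (non-abelian, inequality) form of that count: Stokes in squares on each `□_N(x)` ((7) `dist1_rect_sq_le`: `N²·Σ_{p∈□}`), then the
coverage of the slab by the `N³` cornered squares — every plaquette of the `2N × 2N × N` slab lies in at most `N²` of them (the product of two tents `W(a)·W(b) ≤ N²`).

WHAT.  §1 `sum_range_add_le` (1-D tent coverage: `Σ_{s<N}Σ_{r<N} g(s+r) ≤ N·Σ_{a<2N−1} g(a)` for `g ≥ 0`), `sum_range_add_add_le` (2-D: `≤ N²·Σ_{a,b<2N−1}`).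
§2 `corner_plaq_eq` (torus bookkeeping: the plaquette `(s,t)` of the square cornered at `x₀ + s_μe_μ + s_νe_ν + s_ρe_ρ` is the slab plaquette `(s_μ+s, s_ν+t, s_ρ)`).
§3 ★★`sum_corner_dist1_square_sq_le` — **`Σ_{s_μ,s_ν,s_ρ<N} dist1 U(∂□_N(x₀+s))² ≤ N⁴ · Σ_{c<N} Σ_{a<2N−1} Σ_{b<2N−1} dist1 U(∂p_{a,b,c})²`** (`μ ≠ ν`; `p_{a,b,c}` the
plaquette at `x₀ + a e_μ + b e_ν + c e_ρ` in the `(μ,ν)`-plane, written as the `1 × 1` rectangle holonomy); ★`sq_sum_corner_dist1_square_le` — the Jensen∕Cauchy–Schwarz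
form `(Σ_x dist1 U(∂□_N(x)))² ≤ N³ · N⁴ · Σ_slab`, i.e. `(E_x dist1)² ≤ E_x dist1² ≤ N · Σ_slab dist1²`.

HONEST: kinematics (subadditivity and conjugation invariance of `dist1` through (7), Cauchy–Schwarz, reindexing); constant `1` where the linear count gives `4∕9` (the
squared tent mass is not used); NOT the coupling identity «averaged loop = corner-averaged squares + covariance terms» (the (γ)∕(b3)-class input), NOT the KEY LEMMA's
nonlinear assembly, NOT hFlat; nothing of Bałaban's analysis; TUBE-REG∘, GAP♯∘, EXW∘, S2β, crux 20520 NOT proved; no registered stub is closed; rung R3 = SU(2) YM₃ on T³ —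
NOT d = 4, NOT infinite volume, NOT a mass gap, NOT Clay; the Yang–Mills mass gap is NOT proved.  Sorry-free, axioms standard.

References: T. Bałaban, CMP **98** (1985) 17–51 [Balaban1985Averaging] ((9) p.19, (19) p.21); CMP **99** (1985) 75–102 [Balaban1985RegularSpaces] (Lemma 1 p.79);
CMP **96** (1984) 223–250 [Balaban1984PropagatorsII] ((1.33)).
-/

set_option autoImplicit false

noncomputable section

namespace Summit.QuantumFields.YangMills.Theorems.FluctuationComparisonRegPrIntLS2BetaCornerSquareStokes

open Finset
open Literature.MathematicalPhysics.QuantumFieldTheory.Balaban1983to89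
open B10Eq47AxialChi (shiftN shiftN_zero shiftN_succ rowProd rect rect_one_one dist1_rect_le)
open Summit.QuantumFields.YangMills.Theorems.FluctuationComparisonRegPrIntLS2BetaRowTransportVariance
  (shiftN_comm shiftN_add dist1_rect_sq_le)

/-! ## §1 Tent coverage in one and two directions -/

/-- **1-D tent coverage**: `Σ_{s<N} Σ_{r<N} g(s+r) ≤ N·Σ_{a<2N−1} g(a)` for `g ≥ 0` (each `a` is hit by `W(a) = min(a+1, N, 2N−1−a) ≤ N` pairs `(s,r)`; we only use `≤ N`).
[folklore] -/
theorem sum_range_add_le (N : ℕ) (g : ℕ → ℝ) (hg : ∀ a, 0 ≤ g a) :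
    ∑ s ∈ range N, ∑ r ∈ range N, g (s + r) ≤ (N : ℝ) * ∑ a ∈ range (2 * N - 1), g a := by
  have h1 : ∀ s ∈ range N, ∑ r ∈ range N, g (s + r) ≤ ∑ a ∈ range (2 * N - 1), g a := by
    intro s hs
    rw [Finset.mem_range] at hs
    have e : ∑ r ∈ range N, g (s + r) = ∑ a ∈ Ico s (s + N), g a := by
      rw [Finset.sum_Ico_eq_sum_range, Nat.add_sub_cancel_left]
    rw [e]
    exact Finset.sum_le_sum_of_subset_of_nonneg
      (fun a ha => by rw [Finset.mem_Ico] at ha; rw [Finset.mem_range]; omega) (fun a _ _ => hg a)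
  calc ∑ s ∈ range N, ∑ r ∈ range N, g (s + r) ≤ ∑ _s ∈ range N, ∑ a ∈ range (2 * N - 1), g a := Finset.sum_le_sum h1
    _ = (N : ℝ) * ∑ a ∈ range (2 * N - 1), g a := by rw [Finset.sum_const, Finset.card_range, nsmul_eq_mul]

/-- **2-D tent coverage**: `Σ_{s,t<N} Σ_{r,q<N} F(s+r, t+q) ≤ N²·Σ_{a,b<2N−1} F(a,b)` for `F ≥ 0` (written with the two corner sums outside and the two in-square sums inside).
[folklore] -/
theorem sum_range_add_add_le (N : ℕ) (F : ℕ → ℕ → ℝ) (hF : ∀ a b, 0 ≤ F a b) :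
    ∑ s ∈ range N, ∑ t ∈ range N, ∑ r ∈ range N, ∑ q ∈ range N, F (s + r) (t + q) ≤
      (N : ℝ) ^ 2 * ∑ a ∈ range (2 * N - 1), ∑ b ∈ range (2 * N - 1), F a b := by
  -- swap the `t`- and `r`-sums, apply the 1-D bound in `(t,q)` for each `(s,r)`, then in `(s,r)`
  have inner : ∀ s r, ∑ t ∈ range N, ∑ q ∈ range N, F (s + r) (t + q) ≤ (N : ℝ) * ∑ b ∈ range (2 * N - 1), F (s + r) b :=
    fun s r => sum_range_add_le N (fun b => F (s + r) b) (fun b => hF _ _)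
  calc ∑ s ∈ range N, ∑ t ∈ range N, ∑ r ∈ range N, ∑ q ∈ range N, F (s + r) (t + q)
      = ∑ s ∈ range N, ∑ r ∈ range N, ∑ t ∈ range N, ∑ q ∈ range N, F (s + r) (t + q) :=
        Finset.sum_congr rfl fun s _ => Finset.sum_comm
    _ ≤ ∑ s ∈ range N, ∑ r ∈ range N, (N : ℝ) * ∑ b ∈ range (2 * N - 1), F (s + r) b :=
        Finset.sum_le_sum fun s _ => Finset.sum_le_sum fun r _ => inner s r
    _ = (N : ℝ) * ∑ s ∈ range N, ∑ r ∈ range N, ∑ b ∈ range (2 * N - 1), F (s + r) b := by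
        rw [Finset.mul_sum]; refine Finset.sum_congr rfl fun s _ => ?_; rw [Finset.mul_sum]
    _ ≤ (N : ℝ) * ((N : ℝ) * ∑ a ∈ range (2 * N - 1), ∑ b ∈ range (2 * N - 1), F a b) :=
        mul_le_mul_of_nonneg_left (sum_range_add_le N (fun a => ∑ b ∈ range (2 * N - 1), F a b)
          (fun a => Finset.sum_nonneg fun b _ => hF a b)) (Nat.cast_nonneg N)
    _ = _ := by ring

/-! ## §2 Torus bookkeeping: the plaquettes of a cornered square are slab plaquettes -/

variable {P : Params} {j : ℕ} {G : Type*} [GaugeGroup G]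

/-- The plaquette `(s,t)` of the square cornered at `x₀ + s_μ e_μ + s_ν e_ν + s_ρ e_ρ` sits at the slab position `(s_μ + s, s_ν + t, s_ρ)`:
`((x₀ + s_μe_μ + s_νe_ν + s_ρe_ρ) + t e_ν) + s e_μ = x₀ + (s_μ+s)e_μ + (s_ν+t)e_ν + s_ρe_ρ`. [cite: Balaban1984PropagatorsI, (1.7) p.18] -/
theorem corner_plaq_eq (x₀ : Site P j) (μ ν ρ : Fin P.d) (sμ sν sρ s t : ℕ) :
    shiftN (shiftN (shiftN (shiftN (shiftN x₀ μ sμ) ν sν) ρ sρ) ν t) μ s =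
      shiftN (shiftN (shiftN x₀ μ (sμ + s)) ν (sν + t)) ρ sρ := by
  rw [shiftN_comm (shiftN (shiftN (shiftN x₀ μ sμ) ν sν) ρ sρ) μ ν s t,
    ← shiftN_comm (shiftN (shiftN x₀ μ sμ) ν sν) ρ μ sρ s,
    ← shiftN_comm (shiftN x₀ μ sμ) ν μ sν s, shiftN_add x₀ μ sμ s,
    ← shiftN_comm (shiftN (shiftN x₀ μ (sμ + s)) ν sν) ρ ν sρ t, shiftN_add (shiftN x₀ μ (sμ + s)) ν sν t]

/-! ## §3 The corner-averaged square Stokes bound -/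

/-- ★★ **CORNER-AVERAGED FLAT-SQUARE STOKES WITH TENT COVERAGE** (`μ ≠ ν`, any gauge group, any torus): summing Stokes-in-squares over the `N³` squares of side `N` in
the `(μ,ν)`-plane cornered at the points `x₀ + s_μe_μ + s_νe_ν + s_ρe_ρ` (`s_• < N`) and charging each slab plaquette to the at most `N²` squares containing it,
`Σ_{s_μ,s_ν,s_ρ<N} dist1 U(∂□_N)² ≤ N⁴ · Σ_{c<N} Σ_{a<2N−1} Σ_{b<2N−1} dist1 U(∂p_{a,b,c})²` — i.e. the corner-MEAN of `dist1²` is at most `N ×` the slab's plaquette sum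
(«coverage `1∕N` × area `N²`»). [cite: Balaban1985Averaging, (19) p.21; Balaban1985RegularSpaces, Lemma 1 p.79] -/
theorem sum_corner_dist1_square_sq_le (U : GaugeField P j G) (x₀ : Site P j) {μ ν : Fin P.d} (hμν : μ ≠ ν) (ρ : Fin P.d) (N : ℕ) :
    ∑ sμ ∈ range N, ∑ sν ∈ range N, ∑ sρ ∈ range N,
        dist1 (rect U (shiftN (shiftN (shiftN x₀ μ sμ) ν sν) ρ sρ) μ ν N N) ^ 2 ≤
      (N : ℝ) ^ 4 * ∑ sρ ∈ range N, ∑ a ∈ range (2 * N - 1), ∑ b ∈ range (2 * N - 1),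
        dist1 (rect U (shiftN (shiftN (shiftN x₀ μ a) ν b) ρ sρ) μ ν 1 1) ^ 2 := by
  -- Stokes in squares at each corner, plaquettes rewritten as slab plaquettes
  have hsq : ∀ sμ sν sρ, dist1 (rect U (shiftN (shiftN (shiftN x₀ μ sμ) ν sν) ρ sρ) μ ν N N) ^ 2 ≤
      (N : ℝ) ^ 2 * ∑ t ∈ range N, ∑ s ∈ range N,
        dist1 (rect U (shiftN (shiftN (shiftN x₀ μ (sμ + s)) ν (sν + t)) ρ sρ) μ ν 1 1) ^ 2 := by
    intro sμ sν sρ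
    have h := dist1_rect_sq_le U (shiftN (shiftN (shiftN x₀ μ sμ) ν sν) ρ sρ) hμν N N
    simp only [corner_plaq_eq] at h
    refine h.trans (le_of_eq ?_)
    push_cast; ring
  -- the slab function
  set F : ℕ → ℕ → ℕ → ℝ := fun sρ a b => dist1 (rect U (shiftN (shiftN (shiftN x₀ μ a) ν b) ρ sρ) μ ν 1 1) ^ 2 with hFdef
  have hF0 : ∀ sρ a b, 0 ≤ F sρ a b := fun _ _ _ => sq_nonneg _
  calc ∑ sμ ∈ range N, ∑ sν ∈ range N, ∑ sρ ∈ range N, dist1 (rect U (shiftN (shiftN (shiftN x₀ μ sμ) ν sν) ρ sρ) μ ν N N) ^ 2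
      ≤ ∑ sμ ∈ range N, ∑ sν ∈ range N, ∑ sρ ∈ range N,
          ((N : ℝ) ^ 2 * ∑ t ∈ range N, ∑ s ∈ range N, F sρ (sμ + s) (sν + t)) :=
        Finset.sum_le_sum fun sμ _ => Finset.sum_le_sum fun sν _ => Finset.sum_le_sum fun sρ _ => hsq sμ sν sρ
    _ = ∑ sμ ∈ range N, ∑ sρ ∈ range N, ∑ sν ∈ range N,
          ((N : ℝ) ^ 2 * ∑ t ∈ range N, ∑ s ∈ range N, F sρ (sμ + s) (sν + t)) :=
        Finset.sum_congr rfl fun _ _ => Finset.sum_comm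
    _ = ∑ sρ ∈ range N, ∑ sμ ∈ range N, ∑ sν ∈ range N,
          ((N : ℝ) ^ 2 * ∑ t ∈ range N, ∑ s ∈ range N, F sρ (sμ + s) (sν + t)) := Finset.sum_comm
    _ = ∑ sρ ∈ range N, ∑ sμ ∈ range N, ∑ sν ∈ range N,
          ((N : ℝ) ^ 2 * ∑ s ∈ range N, ∑ t ∈ range N, F sρ (sμ + s) (sν + t)) := by
        refine Finset.sum_congr rfl fun _ _ => Finset.sum_congr rfl fun _ _ => Finset.sum_congr rfl fun _ _ => ?_
        rw [Finset.sum_comm]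
    _ = (N : ℝ) ^ 2 * ∑ sρ ∈ range N, ∑ sμ ∈ range N, ∑ sν ∈ range N, ∑ s ∈ range N, ∑ t ∈ range N, F sρ (sμ + s) (sν + t) := by
        simp only [Finset.mul_sum]
    _ ≤ (N : ℝ) ^ 2 * ∑ sρ ∈ range N, ((N : ℝ) ^ 2 * ∑ a ∈ range (2 * N - 1), ∑ b ∈ range (2 * N - 1), F sρ a b) :=
        mul_le_mul_of_nonneg_left (Finset.sum_le_sum fun sρ _ => sum_range_add_add_le N (F sρ) (hF0 sρ)) (by positivity)
    _ = _ := by rw [← Finset.mul_sum]; ring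

/-- ★ **The Jensen ∕ Cauchy–Schwarz form**: `(Σ_{corners} dist1 U(∂□_N))² ≤ N³ · N⁴ · Σ_slab dist1 U(∂p)²` — dividing by `N⁶`: `(E_x dist1 U(∂□_N(x)))² ≤ E_x dist1² ≤ N·Σ_slab`,
the form the corner-coupled mean part consumes. [cite: Balaban1985Averaging, (19) p.21; Balaban1985RegularSpaces, Lemma 1 p.79] -/
theorem sq_sum_corner_dist1_square_le (U : GaugeField P j G) (x₀ : Site P j) {μ ν : Fin P.d} (hμν : μ ≠ ν) (ρ : Fin P.d) (N : ℕ) :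
    (∑ sμ ∈ range N, ∑ sν ∈ range N, ∑ sρ ∈ range N,
        dist1 (rect U (shiftN (shiftN (shiftN x₀ μ sμ) ν sν) ρ sρ) μ ν N N)) ^ 2 ≤
      (N : ℝ) ^ 3 * ((N : ℝ) ^ 4 * ∑ sρ ∈ range N, ∑ a ∈ range (2 * N - 1), ∑ b ∈ range (2 * N - 1),
        dist1 (rect U (shiftN (shiftN (shiftN x₀ μ a) ν b) ρ sρ) μ ν 1 1) ^ 2) := by
  -- Cauchy–Schwarz three times (each over `range N`), then §3
  have cs3 : (∑ sμ ∈ range N, ∑ sν ∈ range N, ∑ sρ ∈ range N,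
        dist1 (rect U (shiftN (shiftN (shiftN x₀ μ sμ) ν sν) ρ sρ) μ ν N N)) ^ 2 ≤
      (N : ℝ) ^ 3 * ∑ sμ ∈ range N, ∑ sν ∈ range N, ∑ sρ ∈ range N,
        dist1 (rect U (shiftN (shiftN (shiftN x₀ μ sμ) ν sν) ρ sρ) μ ν N N) ^ 2 := by
    have hN : (0 : ℝ) ≤ N := Nat.cast_nonneg N
    have c1 := @sq_sum_le_card_mul_sum_sq ℕ ℝ _ _ _ _ (range N)
      (fun sμ => ∑ sν ∈ range N, ∑ sρ ∈ range N, dist1 (rect U (shiftN (shiftN (shiftN x₀ μ sμ) ν sν) ρ sρ) μ ν N N))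
    have c2 : ∀ sμ, (∑ sν ∈ range N, ∑ sρ ∈ range N, dist1 (rect U (shiftN (shiftN (shiftN x₀ μ sμ) ν sν) ρ sρ) μ ν N N)) ^ 2 ≤
        (N : ℝ) * ∑ sν ∈ range N, (∑ sρ ∈ range N, dist1 (rect U (shiftN (shiftN (shiftN x₀ μ sμ) ν sν) ρ sρ) μ ν N N)) ^ 2 := by
      intro sμ
      have := @sq_sum_le_card_mul_sum_sq ℕ ℝ _ _ _ _ (range N)
        (fun sν => ∑ sρ ∈ range N, dist1 (rect U (shiftN (shiftN (shiftN x₀ μ sμ) ν sν) ρ sρ) μ ν N N))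
      rwa [Finset.card_range] at this
    have c3 : ∀ sμ sν, (∑ sρ ∈ range N, dist1 (rect U (shiftN (shiftN (shiftN x₀ μ sμ) ν sν) ρ sρ) μ ν N N)) ^ 2 ≤
        (N : ℝ) * ∑ sρ ∈ range N, dist1 (rect U (shiftN (shiftN (shiftN x₀ μ sμ) ν sν) ρ sρ) μ ν N N) ^ 2 := by
      intro sμ sν
      have := @sq_sum_le_card_mul_sum_sq ℕ ℝ _ _ _ _ (range N)
        (fun sρ => dist1 (rect U (shiftN (shiftN (shiftN x₀ μ sμ) ν sν) ρ sρ) μ ν N N))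
      rwa [Finset.card_range] at this
    rw [Finset.card_range] at c1
    calc _ ≤ (N : ℝ) * ∑ sμ ∈ range N, (∑ sν ∈ range N, ∑ sρ ∈ range N,
            dist1 (rect U (shiftN (shiftN (shiftN x₀ μ sμ) ν sν) ρ sρ) μ ν N N)) ^ 2 := c1
      _ ≤ (N : ℝ) * ∑ sμ ∈ range N, ((N : ℝ) * ∑ sν ∈ range N, ((N : ℝ) * ∑ sρ ∈ range N,
            dist1 (rect U (shiftN (shiftN (shiftN x₀ μ sμ) ν sν) ρ sρ) μ ν N N) ^ 2)) :=
          mul_le_mul_of_nonneg_left (Finset.sum_le_sum fun sμ _ => (c2 sμ).trans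
            (mul_le_mul_of_nonneg_left (Finset.sum_le_sum fun sν _ => c3 sμ sν) hN)) hN
      _ = _ := by simp only [Finset.mul_sum]; ring_nf
  exact cs3.trans (mul_le_mul_of_nonneg_left (sum_corner_dist1_square_sq_le U x₀ hμν ρ N) (by positivity))

end Summit.QuantumFields.YangMills.Theorems.FluctuationComparisonRegPrIntLS2BetaCornerSquareStokes

end
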